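import Summits.CriticalPhenomena.CardyFormulaZ2.Theorems.CardyComplexConeEdgePrecompactUFRSHalfPlaneArmsReimer
import Summits.CriticalPhenomena.CardyFormulaZ2.Theorems.CardyComplexConeEdgePrecompactUFRSMarkedDecayRectLocal
import Summits.CriticalPhenomena.CardyFormulaZ2.Theorems.CardyComplexConeEdgePrecompactUFRSFlatThreeStrandDecayOfArms
import Literature.Probability.Percolation.NewmanSchulman

/-!
# Tools for HT from the dichotomy: frame arm events (probability, locality), three slots, level sums
(line `qkz-strip-boundary-arm` of crux `CardyComplexCone.EdgePrecompact`, stmt-CriticalPhenomena-11387;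
support of the registered bridge `ufrs_rect_flatThreeStrandDecay` (HT) through its conditional form
`ufrs_rect_flatThreeStrandDecay_of_dichotomy`; worker W-HT of lead c5, wave 4)

The flat three-strand decay HT is proved from the deterministic dichotomy-extraction lemma
`ufrs_rect_threeStrands_dichotomy` (registered, open) by a multi-scale induction: three mixed-tag
strands across `A(z; s, S)` either give three loose genuine half-plane arms of `ω` at `z` (GOOD),
or, at the dyadic level `ρ` of the first fake touchdown, loose arms at `z` up to `ρ`, loose arms
in a window of size `η` at one of `≤ N₀ ρ/η` grid points `p` of the shell `(ρ/2, 3ρ)`, and three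
strands across `A(z; 4ρ, S)` — three events read on disjoint sets of edges. This file supplies the
generic pieces of that computation:

* `real_frameArms_le_HT4` — the loose three-arm bound in ANY lattice frame in the scale format of
  the dichotomy (`m δ ≤ K₀ u`, `ρ ≤ K₀ R δ`): `P ≤ max C 1 · (2 K K₀² u/ρ)^{1+α}` (frame invariance
  `real_preimage_relabel_hpLooseArms` and the unconditional HT-B
  `hpLooseArms_three_decay_of_two hpLooseArms_two_decay`, fed in as a hypothesis);
* `ufrs_frameArms_local` (registered anchor) — locality of a frame arm event: it is determined by
  the pairs of lattice points `x` satisfying any property shared by the images `φ⁻¹ a` of the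
  sites `a ∈ armSites j 1 R` (`determinedBy_hpLooseArms`, `DeterminedBy.preimage_relabel`);
* `real_inter3_HT4` — **three slots**: an event read inside `B(z, ρ/2)`, an event read in the
  shell `(ρ/2, 3ρ)` and the strand event `ufrsStrands E w z k (4ρ) S'` (read beyond `4ρ - 2δ`)
  are independent under `P_{1/2}` (`bondPercolation_real_inter_of_disjoint` twice);
* `sum_levels_le_HT4` — the geometric level sum `Σ_{k : t ≤ S/2^{k+1}} (t 2^{k+1}/S)^γ ≤ (1 - 2^{-γ})⁻¹`.

References: G. F. Lawler, O. Schramm, W. Werner, Electron. J. Probab. 7 (2002), App. A;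
G. Grimmett, *Percolation* (1999), §1.6, §2.2 (invariance, local events, product measure).
-/

namespace Summit.CriticalPhenomena.CardyFormulaZ2.Cruxes.EdgePrecompact.QkzStripBoundaryArm

open MeasureTheory Filter Set Metric
open scoped Topology BigOperators Pointwise
open Literature.Probability.LatticeModels Literature.Probability.Percolation
open Literature.Probability.RandomPlanarGeometry (DobrushinDomain)
open Summit.CriticalPhenomena.CardyFormulaZ2.Theses.CardyComplexCone

noncomputable section

/-! ## Frame arm events: probability -/

/-- **The loose three-arm bound in a lattice frame, scale format.** If the loose three-arm bound
`P(hpLooseArms j 3 m R) ≤ C (m/n)^{1+α}` (`1 ≤ m ≤ n`, `K n ≤ R`) holds, then for a window `m`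
with `m δ ≤ K₀ u` and a reach `R` with `ρ ≤ K₀ R δ` the frame arm event has probability at most
`max C 1 · (2 K K₀² u/ρ)^{1+α}` (the bound is `≥ 1` when `R < 2 K m`). -/
theorem real_frameArms_le_HT4 {C α : ℝ} {K : ℕ} (hα : 0 < α) (hK : 1 ≤ K)
    (hBd : ∀ (j : ℤ) (m n R : ℕ), 1 ≤ m → m ≤ n → K * n ≤ R →
      (bondPercolation (zdGraph 2) half).real (hpLooseArms j 3 m R) ≤ C * ((m : ℝ) / n) ^ (1 + α))
    {K₀ δ u ρ : ℝ} (hK₀ : 1 ≤ K₀) (hδ : 0 < δ) (hu : 0 < u) (hρ : 0 < ρ)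
    (φ : zdGraph 2 ≃g zdGraph 2) (j : ℤ) {m R : ℕ} (hm : 1 ≤ m) (hmu : (m : ℝ) * δ ≤ K₀ * u)
    (hρR : ρ ≤ K₀ * R * δ) :
    (bondPercolation (zdGraph 2) half).real (BondConfig.relabel (sym2Equiv φ.toEquiv) ⁻¹' hpLooseArms j 3 m R) ≤
      max C 1 * (2 * K * K₀ ^ 2 * (u / ρ)) ^ (1 + α) := by
  rw [real_preimage_relabel_hpLooseArms]
  set μ := bondPercolation (zdGraph 2) half with hμ
  have hKr : (1 : ℝ) ≤ K := by exact_mod_cast hK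
  have hm0 : (0 : ℝ) < m := by exact_mod_cast hm
  have hC1 : 1 ≤ max C 1 := le_max_right _ _
  have hCC : C ≤ max C 1 := le_max_left _ _
  have hK₀0 : 0 < K₀ := by linarith
  rcases lt_or_ge (R : ℝ) (2 * K * m) with hsmall | hbig
  · -- trivial bound: the ratio is at least one
    have h1 : ρ ≤ 2 * K * K₀ ^ 2 * u := by
      have e1 : K₀ * R * δ ≤ K₀ * (2 * K * m) * δ :=
        mul_le_mul_of_nonneg_right (mul_le_mul_of_nonneg_left hsmall.le hK₀0.le) hδ.le
      calc ρ ≤ K₀ * R * δ := hρR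
        _ ≤ K₀ * (2 * K * m) * δ := e1
        _ = 2 * K * K₀ * ((m : ℝ) * δ) := by ring
        _ ≤ 2 * K * K₀ * (K₀ * u) := mul_le_mul_of_nonneg_left hmu (by positivity)
        _ = 2 * K * K₀ ^ 2 * u := by ring
    have hratio : 1 ≤ 2 * K * K₀ ^ 2 * (u / ρ) := by
      rw [mul_div_assoc', le_div_iff₀ hρ, one_mul]; exact h1
    calc μ.real (hpLooseArms j 3 m R) ≤ 1 := measureReal_le_one
      _ ≤ (2 * K * K₀ ^ 2 * (u / ρ)) ^ (1 + α) := Real.one_le_rpow hratio (by linarith)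
      _ ≤ max C 1 * (2 * K * K₀ ^ 2 * (u / ρ)) ^ (1 + α) := le_mul_of_one_le_left (by positivity) hC1
  · -- `R ≥ 2 K m`: the decay bound with `n := R / K`
    have hRnat : 2 * K * m ≤ R := by exact_mod_cast hbig
    set n : ℕ := R / K with hn
    have hmn : m ≤ n := by
      rw [hn, Nat.le_div_iff_mul_le (by omega)]
      calc m * K = K * m := mul_comm _ _
        _ ≤ 2 * (K * m) := Nat.le_mul_of_pos_left _ (by norm_num)
        _ = 2 * K * m := (mul_assoc _ _ _).symm
        _ ≤ R := hRnat
    have hKn : K * n ≤ R := Nat.mul_div_le R K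
    have hn0 : (0 : ℝ) < n := by
      have : 1 ≤ n := hm.trans hmn
      exact_mod_cast this
    refine (hBd j m n R hm hmn hKn).trans ?_
    refine (mul_le_mul_of_nonneg_right hCC (by positivity)).trans ?_
    refine mul_le_mul_of_nonneg_left (Real.rpow_le_rpow (by positivity) ?_ (by linarith)) (by linarith)
    have h2K : 2 * K ≤ R := by
      have : 2 * K * 1 ≤ 2 * K * m := Nat.mul_le_mul_left _ hm
      omega
    have hndiv : (R : ℝ) / (2 * K) ≤ n := div_two_le_natDiv_HT hK h2K
    have h1 : (R : ℝ) ≤ 2 * K * n := by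
      rw [div_le_iff₀ (by positivity)] at hndiv; linarith
    have h2 : (m : ℝ) * ρ ≤ K₀ * u * (K₀ * R) :=
      calc (m : ℝ) * ρ ≤ (m : ℝ) * (K₀ * R * δ) := mul_le_mul_of_nonneg_left hρR (by positivity)
        _ = ((m : ℝ) * δ) * (K₀ * R) := by ring
        _ ≤ (K₀ * u) * (K₀ * R) := mul_le_mul_of_nonneg_right hmu (by positivity)
    rw [div_le_iff₀ hn0,
      show 2 * K * K₀ ^ 2 * (u / ρ) * n = (2 * K * K₀ ^ 2 * u * n) / ρ by ring, le_div_iff₀ hρ]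
    calc (m : ℝ) * ρ ≤ K₀ * u * (K₀ * R) := h2
      _ ≤ K₀ * u * (K₀ * (2 * K * n)) := by gcongr
      _ = 2 * K * K₀ ^ 2 * u * n := by ring

/-! ## Frame arm events: locality and measurability -/

/-- **Locality of frame arm events** (registered anchor `ufrs_frameArms_local`): if every lattice
point `φ⁻¹ a`, `a ∈ armSites j 1 R`, has the property `Q`, then the event "the `φ`-relabelled
configuration has `k` loose arms from the window `m` to reach `R`" is determined by the pairs all
of whose points satisfy `Q` (`determinedBy_hpLooseArms` transported by `DeterminedBy.preimage_relabel`). -/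
theorem ufrs_frameArms_local : ∀ (φ : zdGraph 2 ≃g zdGraph 2) (j : ℤ) (k m R : ℕ) (Q : Site 2 → Prop), (∀ a ∈ Z2HalfPlane.armSites j 1 R, Q (φ.symm a)) → DeterminedBy (BondConfig.relabel (sym2Equiv φ.toEquiv) ⁻¹' hpLooseArms j k m R) {e : Sym2 (Site 2) | ∀ x ∈ e, Q x} := by
  intro φ j k m R Q hQ
  refine (DeterminedBy.preimage_relabel (determinedBy_hpLooseArms j k m R) (sym2Equiv φ.toEquiv)).mono ?_
  rintro _ ⟨q, hq, rfl⟩ x hx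
  rw [Finset.mem_coe, Finset.mem_sym2_iff] at hq
  rw [sym2Equiv_symm, sym2Equiv_apply, Sym2.mem_map] at hx
  obtain ⟨y, hy, rfl⟩ := hx
  exact hQ y (hq y hy)

/-- Frame arm events are measurable. -/
theorem measurableSet_frameArms_HT4 (φ : zdGraph 2 ≃g zdGraph 2) (j : ℤ) (k m R : ℕ) :
    MeasurableSet (BondConfig.relabel (sym2Equiv φ.toEquiv) ⁻¹' hpLooseArms j k m R) :=
  (determinedBy_hpLooseArms j k m R).measurableSet_of_finset.preimage (BondConfig.relabel _).measurable

/-! ## Three slots -/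

/-- **Three slots.** Under `P_{1/2}`, a measurable event read on the pairs inside `B(z, ρ/2)`, a
measurable event read on the pairs in the shell `ρ/2 < dist < 3ρ`, and the strand event
`ufrsStrands E w z k (4ρ) S'` (read on the pairs beyond `4ρ - 2δ ≥ 3ρ`) are independent. -/
theorem real_inter3_HT4 (E : DiscreteDobrushin) (hδ : 0 < E.δ) (w : Site 2) (z : ℂ) (k : ℕ) {ρ S' : ℝ}
    (hρ : 2 * E.δ ≤ ρ) {Z H : Set (BondConfig (Site 2))}
    (hZ : DeterminedBy Z {e : Sym2 (Site 2) | ∀ x ∈ e, dist (meshPoint E.δ x) z < ρ / 2})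
    (hH : DeterminedBy H {e : Sym2 (Site 2) | ∀ x ∈ e, ρ / 2 < dist (meshPoint E.δ x) z ∧ dist (meshPoint E.δ x) z < 3 * ρ})
    (hZm : MeasurableSet Z) (hHm : MeasurableSet H) :
    (bondPercolation (zdGraph 2) half).real (Z ∩ H ∩ ufrsStrands E w z k (4 * ρ) S') =
      (bondPercolation (zdGraph 2) half).real Z * (bondPercolation (zdGraph 2) half).real H *
        (bondPercolation (zdGraph 2) half).real (ufrsStrands E w z k (4 * ρ) S') := by
  have hZH : DeterminedBy (Z ∩ H) {e : Sym2 (Site 2) | ∀ x ∈ e, dist (meshPoint E.δ x) z < 3 * ρ} := by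
    refine (hZ.mono ?_).inter (hH.mono ?_)
    · intro e he x hx; have := he x hx; linarith [this, hδ]
    · intro e he x hx; exact (he x hx).2
  have hOut := determinedBy_ufrsStrands_W3M E w z k (4 * ρ) S' hδ
  rw [bondPercolation_real_inter_of_disjoint (zdGraph 2) half
      (disjoint_edgeBands_W3M (P := fun x => dist (meshPoint E.δ x) z < 3 * ρ)
        (Q := fun x => 4 * ρ - 2 * E.δ ≤ dist (meshPoint E.δ x) z ∧ dist (meshPoint E.δ x) z ≤ S' + 2 * E.δ)
        (fun x h1 h2 => by linarith [h2.1]))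
      hZH hOut (hZm.inter hHm) (measurableSet_ufrsStrands_W3M E w z k (4 * ρ) S' hδ),
    bondPercolation_real_inter_of_disjoint (zdGraph 2) half
      (disjoint_edgeBands_W3M (P := fun x => dist (meshPoint E.δ x) z < ρ / 2)
        (Q := fun x => ρ / 2 < dist (meshPoint E.δ x) z ∧ dist (meshPoint E.δ x) z < 3 * ρ)
        (fun x h1 h2 => by linarith [h2.1]))
      hZ hH hZm hHm]

/-- **Three slots, as a bound**: `P(Z ∩ H ∩ Out) ≤ bZ · bH · bOut` from the three individual bounds. -/
theorem real_inter3_le_HT4 (E : DiscreteDobrushin) (hδ : 0 < E.δ) (w : Site 2) (z : ℂ) (k : ℕ) {ρ S' : ℝ}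
    (hρ : 2 * E.δ ≤ ρ) {Z H : Set (BondConfig (Site 2))}
    (hZ : DeterminedBy Z {e : Sym2 (Site 2) | ∀ x ∈ e, dist (meshPoint E.δ x) z < ρ / 2})
    (hH : DeterminedBy H {e : Sym2 (Site 2) | ∀ x ∈ e, ρ / 2 < dist (meshPoint E.δ x) z ∧ dist (meshPoint E.δ x) z < 3 * ρ})
    (hZm : MeasurableSet Z) (hHm : MeasurableSet H) {bZ bH bO : ℝ}
    (h1 : (bondPercolation (zdGraph 2) half).real Z ≤ bZ) (h2 : (bondPercolation (zdGraph 2) half).real H ≤ bH)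
    (h3 : (bondPercolation (zdGraph 2) half).real (ufrsStrands E w z k (4 * ρ) S') ≤ bO) :
    (bondPercolation (zdGraph 2) half).real (Z ∩ H ∩ ufrsStrands E w z k (4 * ρ) S') ≤ bZ * bH * bO := by
  rw [real_inter3_HT4 E hδ w z k hρ hZ hH hZm hHm]
  have hZ0 : 0 ≤ (bondPercolation (zdGraph 2) half).real Z := measureReal_nonneg
  have hH0 : 0 ≤ (bondPercolation (zdGraph 2) half).real H := measureReal_nonneg
  have hO0 : 0 ≤ (bondPercolation (zdGraph 2) half).real (ufrsStrands E w z k (4 * ρ) S') := measureReal_nonneg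
  have hbZ : 0 ≤ bZ := hZ0.trans h1
  have hbH : 0 ≤ bH := hH0.trans h2
  exact mul_le_mul (mul_le_mul h1 h2 hH0 hbZ) h3 hO0 (mul_nonneg hbZ hbH)

/-! ## The geometric level sum -/

/-- **The level sum.** Over the dyadic levels `ρ_k = S/2^{k+1}` with `t ≤ ρ_k` (`k < N`), the sum
of `(t/ρ_k)^γ` is at most `(1 - 2^{-γ})⁻¹`: the admissible levels form an initial segment
`k ≤ k⋆`, on which `t/ρ_k ≤ 2^{-(k⋆ - k)}`. -/
theorem sum_levels_le_HT4 {t S γ : ℝ} (ht : 0 < t) (hS : 0 < S) (hγ : 0 < γ) (N : ℕ) :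
    ∑ k ∈ (Finset.range N).filter (fun k => t ≤ S / 2 ^ (k + 1)), (t / (S / 2 ^ (k + 1))) ^ γ ≤
      (1 - (1 / 2 : ℝ) ^ γ)⁻¹ := by
  set A := (Finset.range N).filter (fun k => t ≤ S / 2 ^ (k + 1)) with hA
  set q : ℝ := (1 / 2 : ℝ) ^ γ with hq
  have hq0 : 0 ≤ q := by positivity
  have hq1 : q < 1 := Real.rpow_lt_one (by norm_num) (by norm_num) hγ
  have hRHS : 0 ≤ (1 - q)⁻¹ := inv_nonneg.2 (by linarith)
  rcases A.eq_empty_or_nonempty with hAe | hAne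
  · rw [hAe, Finset.sum_empty]; exact hRHS
  set ks : ℕ := A.max' hAne with hks
  have hksA : ks ∈ A := A.max'_mem hAne
  have hks_adm : t ≤ S / 2 ^ (ks + 1) := (Finset.mem_filter.1 hksA).2
  -- termwise comparison with the reflected geometric sequence
  have hterm : ∀ k ∈ A, (t / (S / 2 ^ (k + 1))) ^ γ ≤ q ^ (ks - k) := by
    intro k hk
    have hkks : k ≤ ks := A.le_max' k hk
    have hpos : 0 < S / 2 ^ (k + 1) := by positivity
    -- `t / ρ_k ≤ (1/2)^(ks - k)` since `t ≤ ρ_{ks} = ρ_k / 2^(ks-k)`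
    have hle : t / (S / 2 ^ (k + 1)) ≤ (1 / 2 : ℝ) ^ (ks - k) := by
      rw [div_le_iff₀ hpos]
      have e : (1 / 2 : ℝ) ^ (ks - k) * (S / 2 ^ (k + 1)) = S / 2 ^ (ks + 1) := by
        rw [one_div_pow, div_mul_div_comm, one_mul, ← pow_add,
          show ks - k + (k + 1) = ks + 1 by omega]
      rw [e]; exact hks_adm
    calc (t / (S / 2 ^ (k + 1))) ^ γ ≤ ((1 / 2 : ℝ) ^ (ks - k)) ^ γ :=
          Real.rpow_le_rpow (by positivity) hle hγ.le
      _ = q ^ (ks - k) := by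
          rw [hq, ← Real.rpow_natCast, ← Real.rpow_natCast, ← Real.rpow_mul (by norm_num),
            ← Real.rpow_mul (by norm_num), mul_comm]
  have hsub : A ⊆ Finset.range (ks + 1) := fun k hk => Finset.mem_range.2 (Nat.lt_succ_of_le (A.le_max' k hk))
  calc ∑ k ∈ A, (t / (S / 2 ^ (k + 1))) ^ γ ≤ ∑ k ∈ A, q ^ (ks - k) := Finset.sum_le_sum hterm
    _ ≤ ∑ k ∈ Finset.range (ks + 1), q ^ (ks - k) :=
        Finset.sum_le_sum_of_subset_of_nonneg hsub fun k _ _ => by positivity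
    _ = ∑ k ∈ Finset.range (ks + 1), q ^ k := by
        rw [← Finset.sum_range_reflect (fun k => q ^ k) (ks + 1)]
        refine Finset.sum_congr rfl fun k hk => ?_
        rw [show ks + 1 - 1 - k = ks - k by omega]
    _ ≤ (1 - q)⁻¹ := by
        have := geom_sum_Ico_le_of_lt_one (m := 0) (n := ks + 1) hq0 hq1
        rw [pow_zero, ← Finset.range_eq_Ico] at this
        simpa [one_div] using this

/-! ## The per-level algebra -/

/-- The exponent bookkeeping of one level: count `ρ/η`, arms at `z` `(t/ρ)^{1+α}`, arms at the
touchdown `(η/ρ)^{1+α}`, outer strands `(ρ/S')^{1+α₁}`, regrouped as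
`(η/t)^α (t/S')^{1+α₁} (t/ρ)^{2α-α₁}`. -/
theorem level_algebra_HT4 {η t ρ S' : ℝ} (hη : 0 < η) (ht : 0 < t) (hρ : 0 < ρ) (hS : 0 < S') (α α₁ : ℝ) :
    (ρ / η) * ((t / ρ) ^ (1 + α) * (η / ρ) ^ (1 + α) * (ρ / S') ^ (1 + α₁)) =
      (η / t) ^ α * (t / S') ^ (1 + α₁) * (t / ρ) ^ (2 * α - α₁) := by
  have e1 : ρ / η = Real.exp (Real.log ρ - Real.log η) := by
    rw [Real.exp_sub, Real.exp_log hρ, Real.exp_log hη]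
  rw [e1]
  simp only [Real.rpow_def_of_pos (div_pos ht hρ), Real.rpow_def_of_pos (div_pos hη hρ),
    Real.rpow_def_of_pos (div_pos hρ hS), Real.rpow_def_of_pos (div_pos hη ht),
    Real.rpow_def_of_pos (div_pos ht hS), Real.log_div ht.ne' hρ.ne', Real.log_div hη.ne' hρ.ne',
    Real.log_div hρ.ne' hS.ne', Real.log_div hη.ne' ht.ne', Real.log_div ht.ne' hS.ne', ← Real.exp_add]
  congr 1; ring

/-- **The per-level bound.** At a level of scale `ρ` with `≤ N₀ ρ/η` windows, each window term
bounded by `[C'(K_c t/ρ)^{1+α}] · [C'(K_c η/ρ)^{1+α}] · [C₁ (4ρ/S')^{1+α₁}]`, the level contributes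
at most `A C₁ (η/t)^α (t/S')^{1+α₁} (t/ρ)^{2α-α₁}` with `A = N₀ (C' K_c^{1+α})² 4^{1+α₁}`. -/
theorem level_term_le_HT4 {ι : Type*} (P : Finset ι) (f : ι → ℝ) {N₀ C' Kc C₁ η t ρ S' α α₁ : ℝ}
    (hη : 0 < η) (ht : 0 < t) (hρ : 0 < ρ) (hS : 0 < S') (hC' : 0 ≤ C') (hKc : 0 ≤ Kc) (hC₁ : 0 ≤ C₁)
    (hcard : (P.card : ℝ) ≤ N₀ * ρ / η)
    (hf : ∀ p ∈ P, f p ≤ (C' * (Kc * (t / ρ)) ^ (1 + α)) * (C' * (Kc * (η / ρ)) ^ (1 + α)) * (C₁ * (4 * ρ / S') ^ (1 + α₁))) :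
    ∑ p ∈ P, f p ≤ (N₀ * (C' * Kc ^ (1 + α)) * (C' * Kc ^ (1 + α)) * (4 : ℝ) ^ (1 + α₁)) * C₁ *
      ((η / t) ^ α * (t / S') ^ (1 + α₁) * (t / ρ) ^ (2 * α - α₁)) := by
  set b : ℝ := (C' * (Kc * (t / ρ)) ^ (1 + α)) * (C' * (Kc * (η / ρ)) ^ (1 + α)) * (C₁ * (4 * ρ / S') ^ (1 + α₁)) with hb
  have hb0 : 0 ≤ b := by positivity
  calc ∑ p ∈ P, f p ≤ ∑ _p ∈ P, b := Finset.sum_le_sum hf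
    _ = P.card * b := by rw [Finset.sum_const, nsmul_eq_mul]
    _ ≤ (N₀ * ρ / η) * b := mul_le_mul_of_nonneg_right hcard hb0
    _ = (N₀ * (C' * Kc ^ (1 + α)) * (C' * Kc ^ (1 + α)) * (4 : ℝ) ^ (1 + α₁)) * C₁ *
          ((ρ / η) * ((t / ρ) ^ (1 + α) * (η / ρ) ^ (1 + α) * (ρ / S') ^ (1 + α₁))) := by
        rw [hb, Real.mul_rpow (x := Kc) (y := t / ρ) hKc (by positivity),
          Real.mul_rpow (x := Kc) (y := η / ρ) hKc (by positivity), mul_div_assoc (4 : ℝ) ρ S',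
          Real.mul_rpow (x := (4 : ℝ)) (y := ρ / S') (by norm_num) (by positivity)]
        ring
    _ = _ := by rw [level_algebra_HT4 hη ht hρ hS α α₁]

/-- **The sum over the admissible levels** `Λ₀ t ≤ ρ_k = S'/2^{k+1}`, `k < N`, of
`B (t/ρ_k)^γ` is at most `B (1 - 2^{-γ})⁻¹` (`sum_levels_le_HT4` at `Λ₀ t ≥ t`). -/
theorem levels_sum_le_HT4 {Λ₀ t S' γ B : ℝ} (hΛ₀ : 1 ≤ Λ₀) (ht : 0 < t) (hS : 0 < S') (hγ : 0 < γ) (hB : 0 ≤ B)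
    (N : ℕ) :
    ∑ k ∈ (Finset.range N).filter (fun k => Λ₀ * t ≤ S' / 2 ^ (k + 1)), B * (t / (S' / 2 ^ (k + 1))) ^ γ ≤
      B * (1 - (1 / 2 : ℝ) ^ γ)⁻¹ := by
  rw [← Finset.mul_sum]
  refine mul_le_mul_of_nonneg_left ?_ hB
  have hΛt : 0 < Λ₀ * t := by positivity
  refine le_trans (Finset.sum_le_sum fun k _ => ?_) (sum_levels_le_HT4 hΛt hS hγ N)
  exact Real.rpow_le_rpow (by positivity)
    (div_le_div_of_nonneg_right (le_mul_of_one_le_left ht.le hΛ₀) (by positivity)) hγ.le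

/-- **Admissible levels are few**: `Λ₀ (2s) ≤ S'/2^{k+1}` and `S' ≤ 2^{n+1} s` force `k < n + 1`. -/
theorem level_lt_HT4 {s S' Λ₀ : ℝ} {n k : ℕ} (hs : 0 < s) (hΛ₀ : 1 ≤ Λ₀) (hS : S' ≤ 2 ^ (n + 1) * s)
    (hk : Λ₀ * (2 * s) ≤ S' / 2 ^ (k + 1)) : k < n + 1 := by
  by_contra hkn
  push Not at hkn
  have h1 : 2 * s ≤ S' / 2 ^ (k + 1) := le_trans (le_mul_of_one_le_left (by linarith) hΛ₀) hk
  rw [le_div_iff₀ (by positivity)] at h1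
  have h2 : (2 : ℝ) ^ (n + 2) ≤ 2 ^ (k + 1) := pow_le_pow_right₀ (by norm_num) (by omega)
  have h3 : (2 : ℝ) ^ (n + 2) = 2 * 2 ^ (n + 1) := by ring
  nlinarith [pow_pos (two_pos : (0 : ℝ) < 2) (n + 1)]

end

end Summit.CriticalPhenomena.CardyFormulaZ2.Cruxes.EdgePrecompact.QkzStripBoundaryArm
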